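import Summits.ResolutionOfSingularities.ResolutionOfSingularities.Theorems.FrobeniusLadderFInjectiveMacaulayficationDominatingLocFixLocalDimLe2
import HarnessLib

/-!
# The dominating cure `J₀ · J″` near a residual point of local dimension `≤ 2` (Lipman), and at EVERY point of local dimension `≤ 3`
# (crux `FInjectiveMacaulayfication` stmt-ResolutionOfSingularities-15315, chain w45a; res-L1-w45a-plan-1 R16.43 (c) / R16.46 (4); seat res-L1-w45a-stub-1 g6)

[OURS · L1 W4.5a] Support file (`--supports stmt-ResolutionOfSingularities-15315 --as helper`); NOT a statement of any manuscript; def-free;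
THEOREMS modulo Lipman 1978 / Cossart–Piltant 2019 + Raynaud–Gruson + `NonFullLocusClosed` BY NAME; AI-written (AI review is weaker than expert
review).

* `exists_dominating_cure_dimLe2 (hL hNF)`: for `J₀ ≠ ⊥`, a point `ζ` with `dim 𝒪_{X₁,ζ} ≤ 2` (binders of the (A′) route: `X₁` integral of
  finite type over `k`, quasi-compact, Cohen–Macaulay stalks) there are `J″ ≠ ⊥` and an open `U ∋ ζ` with every blowing up along `J₀ · J″` FULL
  over `U` and `GoodOver p X₁ (J₀ * J″) U` — `DominatingLocFixLocalDimLe2.exists_productCompatible_locFix_dimLe2` fed into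
  `DominatingLocFix.exists_dominating_goodOver_nhd`.
* `exists_dominating_cure_locDimLe3 (hL hG h081R hP hNF)`: the same at EVERY point with `dim 𝒪_ζ ≤ 3` — i.e. at every NON-CLOSED point of a
  fourfold — by cases `≤ 2` (Lipman) / `= 3` (`DominatingLocFixLocal.exists_dominating_cure_dimThree`, Cossart–Piltant).
[cite: Liu2002, Thm. 8.3.44 (PDF p. 427)] [cite: CossartPiltant2019, Thm. 1.1 (i)(ii); Prop. 4.4] [cite: DattaMurayama2024, Thm. B]
-/

-- single-problem summit: the doubled namespace component is forced
set_option linter.dupNamespace false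

noncomputable section

namespace Summit.ResolutionOfSingularities.ResolutionOfSingularities.Theorems.FInjectiveMacaulayfication.DominatingLocFixLocalDimLe2Cure

open CategoryTheory CategoryTheory.Limits AlgebraicGeometry TopologicalSpace IsLocalRing
open Literature.AlgebraicGeometry.Resolution
open Summit.ResolutionOfSingularities.ResolutionOfSingularities.Theorems.FInjectiveMacaulayfication
open SliceableCentre FCUnguardedAprime

/-- **The dominating cure at local dimension `≤ 2`** (Lipman + `NonFullLocusClosed`). [OURS · conditional-result]
[cite: Liu2002, Thm. 8.3.44 (PDF p. 427)] [cite: DattaMurayama2024, Thm. B] -/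
theorem exists_dominating_cure_dimLe2 (hL : Lipman1978SequenceFinite.{0}) (hNF : NonFullLocusClosed.NonFullLocusClosed)
    (p : ℕ) (hp : p.Prime) (k : Type) [Field k] [CharP k p] (X₁ : Scheme.{0}) (f₁ : X₁ ⟶ Spec (.of k))
    [LocallyOfFiniteType f₁] [QuasiCompact f₁] [IsIntegral X₁] (hCM : ∀ x : X₁, CMCl (X₁.presheaf.stalk x))
    (J₀ : X₁.IdealSheafData) (hJ₀ : J₀ ≠ ⊥) (ζ : X₁) (hdim : ringKrullDim (X₁.presheaf.stalk ζ) ≤ 2) :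
    ∃ (J'' : X₁.IdealSheafData) (U : X₁.Opens), J'' ≠ ⊥ ∧ ζ ∈ (U : Set X₁) ∧
      (∀ (X₂ : Scheme.{0}) (π : X₂ ⟶ X₁), IsBlowup π (J₀ * J'') → ∀ x : X₂, π.base x ∈ (U : Set X₁) → FullCl p (X₂.presheaf.stalk x)) ∧
      GoodOver p X₁ (J₀ * J'') (U : Set X₁) := by
  haveI : Fact p.Prime := ⟨hp⟩
  obtain ⟨m, c, n, d, hc0, hd, hfull⟩ :=
    DominatingLocFixLocalDimLe2.exists_productCompatible_locFix_dimLe2 hL p f₁ hCM ζ hdim J₀ hJ₀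
  obtain ⟨J'', U, hJ'', -, hζU, hU, hgood⟩ := DominatingLocFix.exists_dominating_goodOver_nhd hNF p hp k X₁ f₁ J₀ hJ₀ ζ c hc0 d hd
    (fun j 𝔔 _ => (hfull j 𝔔).2)
  exact ⟨J'', U, hJ'', hζU, hU, hgood⟩

/-- **The dominating cure at EVERY point of local dimension `≤ 3`** — every non-closed point of a fourfold — by cases: `dim 𝒪_ζ ≤ 2` (Lipman)
or `= 3` (Cossart–Piltant). [OURS · conditional-result]
[cite: Liu2002, Thm. 8.3.44 (PDF p. 427)] [cite: CossartPiltant2019, Thm. 1.1 (i)(ii); Prop. 4.4] [cite: DattaMurayama2024, Thm. B] -/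
theorem exists_dominating_cure_locDimLe3 (hL : Lipman1978SequenceFinite.{0})
    (hG : CossartPiltant2019General.{0}) (h081R : Stacks081R.{0}) (hP : CossartPiltant2019Principalization.{0})
    (hNF : NonFullLocusClosed.NonFullLocusClosed)
    (p : ℕ) (hp : p.Prime) (k : Type) [Field k] [CharP k p] (X₁ : Scheme.{0}) (f₁ : X₁ ⟶ Spec (.of k))
    [LocallyOfFiniteType f₁] [QuasiCompact f₁] [IsIntegral X₁] (hCM : ∀ x : X₁, CMCl (X₁.presheaf.stalk x))
    (J₀ : X₁.IdealSheafData) (hJ₀ : J₀ ≠ ⊥) (ζ : X₁) (hdim : ringKrullDim (X₁.presheaf.stalk ζ) ≤ 3) :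
    ∃ (J'' : X₁.IdealSheafData) (U : X₁.Opens), J'' ≠ ⊥ ∧ ζ ∈ (U : Set X₁) ∧
      (∀ (X₂ : Scheme.{0}) (π : X₂ ⟶ X₁), IsBlowup π (J₀ * J'') → ∀ x : X₂, π.base x ∈ (U : Set X₁) → FullCl p (X₂.presheaf.stalk x)) ∧
      GoodOver p X₁ (J₀ * J'') (U : Set X₁) := by
  by_cases h3 : ringKrullDim (X₁.presheaf.stalk ζ) = 3
  · exact DominatingLocFixLocal.exists_dominating_cure_dimThree hG h081R hP hNF p hp k X₁ f₁ J₀ hJ₀ ζ h3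
  · have h2 : ringKrullDim (X₁.presheaf.stalk ζ) ≤ 2 := by
      -- `≤ 3` and `≠ 3` in `WithBot ℕ∞` give `≤ 2`
      generalize hq : ringKrullDim (X₁.presheaf.stalk ζ) = q at hdim h3
      induction q using WithBot.recBotCoe with
      | bot => exact bot_le
      | coe q =>
        induction q using ENat.recTopCoe with
        | top =>
          exfalso
          have h' : ((⊤ : ℕ∞) : WithBot ℕ∞) ≤ ((3 : ℕ∞) : WithBot ℕ∞) := hdim
          rw [WithBot.coe_le_coe] at h'
          exact (ENat.coe_ne_top 3) (top_le_iff.mp h')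
        | coe n =>
          have hle : ((n : ℕ∞) : WithBot ℕ∞) ≤ ((3 : ℕ∞) : WithBot ℕ∞) := hdim
          rw [WithBot.coe_le_coe] at hle
          have hle' : n ≤ 3 := by exact_mod_cast hle
          have hne : n ≠ 3 := by
            intro h
            apply h3
            subst h
            rfl
          have h2n : n ≤ 2 := by omega
          have : ((n : ℕ∞) : WithBot ℕ∞) ≤ ((2 : ℕ∞) : WithBot ℕ∞) := WithBot.coe_le_coe.mpr (by exact_mod_cast h2n)
          exact this
    exact exists_dominating_cure_dimLe2 hL hNF p hp k X₁ f₁ hCM J₀ hJ₀ ζ h2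

end Summit.ResolutionOfSingularities.ResolutionOfSingularities.Theorems.FInjectiveMacaulayfication.DominatingLocFixLocalDimLe2Cure

end
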